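import Summits.HubbardSuperconductivity.HubbardSuperconductivity.Theorems.WeakCouplingBCSKlLindhardEnclosureCeilRulesInRoot

/-!
# KL-MARGIN-SCAN reader (22) «kernel-lindhard-enclosure» — ceiling soundness for ORIENTED cells inside the root square, part 1/2

LOCATED (own files, same day, second scope point): besides lying inside the root square, every cell the fused evaluation `QB.eval` visits is
ORIENTED (`a ≤ b`, `c ≤ d`: the root is, midpoints and guarded cuts preserve it).  The rule predicates of `…CeilRulesInRoot` omit this
invariant, and at least the crude ceiling is NOT sound without it: on a degenerate in-root cell (`b < a`, `c < d`) the cell is empty but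
`ceilCrude` may certify a NEGATIVE numerator, so `CeilCrudeSoundIn` as stated there is too strong to be a discharge target.  This file adds the
orientation invariant: `Params.InRootOrd`, the per-leaf predicate `LeafCeilSoundOrd` (admissible `P`, cell inside the root square AND
oriented), the tree induction `eval_snd_sound_ord` carrying both invariants, and `ceilSoundAt_of_leafCeilSoundOrd : LeafCeilSoundOrd P → ∀ t,
CeilSoundAt P t`.  Part 2 (`…CeilRulesOrd`) states the five ORIENTED rule predicates — the ceiling discharge targets of record — and closes
`CeilSoundAt` from them.  Honest framing: reductions only; nothing in this file asserts a KL margin at any `t′ ≠ 0`, `K₃`, `U₀`, the window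
or B1g dominance; a Kohn–Luttinger instability statement is not ODLRO and nothing here proves superconductivity in the Hubbard model.
(p1 g25, 2026-08-29.)
-/

noncomputable section

set_option linter.dupNamespace false

namespace Summit.HubbardSuperconductivity.HubbardSuperconductivity.Theorems.KlLindhardEnclosure

open Real Set MeasureTheory Literature.MathematicalPhysics.QuantumLattice
open Summit.HubbardSuperconductivity.HubbardSuperconductivity.Theorems

/-- The grid cell `(a, b, c, d)` lies inside the root square AND is oriented (`a ≤ b`, `c ≤ d`) — the full invariant of the cells visited by
`QB.eval` from the root. -/
def Params.InRootOrd (P : Params) (a b c d : ℤ) : Prop := P.InRoot a b c d ∧ a ≤ b ∧ c ≤ d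

/-- Midpoint sub-cells of an oriented in-root cell are oriented in-root cells. -/
theorem Params.InRootOrd.mid (P : Params) {a b c d : ℤ} (h : P.InRootOrd a b c d) :
    P.InRootOrd a ((a + b) / 2) c ((c + d) / 2) ∧ P.InRootOrd ((a + b) / 2) b c ((c + d) / 2) ∧
    P.InRootOrd a ((a + b) / 2) ((c + d) / 2) d ∧ P.InRootOrd ((a + b) / 2) b ((c + d) / 2) d ∧
    P.InRootOrd a ((a + b) / 2) c d ∧ P.InRootOrd ((a + b) / 2) b c d ∧
    P.InRootOrd a b c ((c + d) / 2) ∧ P.InRootOrd a b ((c + d) / 2) d := by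
  unfold Params.InRootOrd Params.InRoot at h ⊢; omega

/-- A guarded x-cut of an oriented in-root cell gives oriented in-root cells. -/
theorem Params.InRootOrd.cutx (P : Params) {a b c d z : ℤ} (h : P.InRootOrd a b c d) (hz : a < z ∧ z < b) :
    P.InRootOrd a z c d ∧ P.InRootOrd z b c d := by
  unfold Params.InRootOrd Params.InRoot at h ⊢; omega

/-- A guarded y-cut of an oriented in-root cell gives oriented in-root cells. -/
theorem Params.InRootOrd.cuty (P : Params) {a b c d z : ℤ} (h : P.InRootOrd a b c d) (hz : c < z ∧ z < d) :
    P.InRootOrd a b c z ∧ P.InRootOrd a b z d := by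
  unfold Params.InRootOrd Params.InRoot at h ⊢; omega

/-- The root cell is an oriented in-root cell (admissible ⇒ `0 ≤ Xz`). -/
theorem Params.inRootOrd_root (P : Params) (hP : P.admissible = true) : P.InRootOrd (-P.Xz) P.Xz (-P.Xz) P.Xz := by
  have h := P.inRoot_root hP
  refine ⟨h, ?_, ?_⟩ <;> · unfold Params.InRoot at h; omega

/-- **ORIENTED PER-LEAF CEILING SOUNDNESS at `P`** (the discharge target of record): admissible `P`, leaf cell inside the root square and
oriented, any hint payload: a certified leaf ceiling `some N` is a certified ceiling of the cell. [folklore] -/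
def LeafCeilSoundOrd (P : Params) : Prop :=
  ∀ (bd : Option (ℕ × ℕ × ℕ × ℕ)) (tp : Option (ℕ × ℕ × ℕ × ℕ × ℕ × ℕ × ℕ × ℕ)) (a b c d N : ℤ),
    P.admissible = true → P.InRoot a b c d → a ≤ b → c ≤ d →
      (P.leaf bd tp (P.mkX a) (P.mkX b) (P.mkY c) (P.mkY d)).2 = some N → P.CeilValid a b c d N

/-- **TREE INDUCTION OVER ORIENTED IN-ROOT CELLS.** -/
theorem eval_snd_sound_ord (P : Params) (hP : P.admissible = true) (hleaf : LeafCeilSoundOrd P) (t : QB) :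
    ∀ a b c d N : ℤ, P.InRootOrd a b c d → (t.eval P (P.mkX a) (P.mkX b) (P.mkY c) (P.mkY d)).2 = some N →
      P.CeilValid a b c d N := by
  have hU : 0 < P.U := P.U_pos_of_admissible hP
  induction t with
  | o => intro a b c d N hin h; exact hleaf none none a b c d N hP hin.1 hin.2.1 hin.2.2 (by simpa [QB.eval] using h)
  | d σx σy τx τy =>
      intro a b c d N hin h
      exact hleaf (some (σx, σy, τx, τy)) none a b c d N hP hin.1 hin.2.1 hin.2.2 (by simpa [QB.eval] using h)
  | w a1 a2 a3 a4 a5 a6 a7 a8 =>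
      intro a b c d N hin h
      exact hleaf none (some (a1, a2, a3, a4, a5, a6, a7, a8)) a b c d N hP hin.1 hin.2.1 hin.2.2 (by simpa [QB.eval] using h)
  | n c00 c10 c01 c11 ih00 ih10 ih01 ih11 =>
      intro a b c d N hin h
      simp only [QB.eval, Params.mkX_z, Params.mkY_z] at h
      obtain ⟨Nl, Nr, hl, hr, hN⟩ := addO_eq_some h
      obtain ⟨N00, N10, h00, h10, hNl⟩ := addO_eq_some hl
      obtain ⟨N01, N11, h01, h11, hNr⟩ := addO_eq_some hr
      obtain ⟨k00, k10, k01, k11, -, -, -, -⟩ := Params.InRootOrd.mid P hin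
      obtain ⟨i00, b00⟩ := ih00 a ((a + b) / 2) c ((c + d) / 2) N00 k00 h00
      obtain ⟨i10, b10⟩ := ih10 ((a + b) / 2) b c ((c + d) / 2) N10 k10 h10
      obtain ⟨i01, b01⟩ := ih01 a ((a + b) / 2) ((c + d) / 2) d N01 k01 h01
      obtain ⟨i11, b11⟩ := ih11 ((a + b) / 2) b ((c + d) / 2) d N11 k11 h11
      obtain ⟨iL, eL⟩ := P.cellInt_merge_x hU (midpoint_between a b) c ((c + d) / 2) i00 i10
      obtain ⟨iU, eU⟩ := P.cellInt_merge_x hU (midpoint_between a b) ((c + d) / 2) d i01 i11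
      obtain ⟨iT, eT⟩ := P.cellInt_merge_y hU a b (midpoint_between c d) iL iU
      refine ⟨iT, ?_⟩
      rw [eT, eL, eU, hN, hNl, hNr]
      push_cast
      linarith
  | cx z l r ihl ihr =>
      intro a b c d N hin h
      simp only [QB.eval, Params.mkX_z] at h
      split_ifs at h with hz
      · obtain ⟨Nl, Nr, hl, hr, hN⟩ := addO_eq_some h
        obtain ⟨kl, kr⟩ := Params.InRootOrd.cutx P hin hz
        obtain ⟨il, bl⟩ := ihl a z c d Nl kl hl
        obtain ⟨ir, br⟩ := ihr z b c d Nr kr hr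
        obtain ⟨iT, eT⟩ := P.cellInt_merge_x hU (Or.inl ⟨hz.1.le, hz.2.le⟩) c d il ir
        refine ⟨iT, ?_⟩
        rw [eT, hN]; push_cast; linarith
  | cy z l r ihl ihr =>
      intro a b c d N hin h
      simp only [QB.eval, Params.mkY_z] at h
      split_ifs at h with hz
      · obtain ⟨Nl, Nr, hl, hr, hN⟩ := addO_eq_some h
        obtain ⟨kl, kr⟩ := Params.InRootOrd.cuty P hin hz
        obtain ⟨il, bl⟩ := ihl a b c z Nl kl hl
        obtain ⟨ir, br⟩ := ihr a b z d Nr kr hr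
        obtain ⟨iT, eT⟩ := P.cellInt_merge_y hU a b (Or.inl ⟨hz.1.le, hz.2.le⟩) il ir
        refine ⟨iT, ?_⟩
        rw [eT, hN]; push_cast; linarith
  | bx l r ihl ihr =>
      intro a b c d N hin h
      simp only [QB.eval, Params.mkX_z] at h
      obtain ⟨Nl, Nr, hl, hr, hN⟩ := addO_eq_some h
      obtain ⟨-, -, -, -, kl, kr, -, -⟩ := Params.InRootOrd.mid P hin
      obtain ⟨il, bl⟩ := ihl a ((a + b) / 2) c d Nl kl hl
      obtain ⟨ir, br⟩ := ihr ((a + b) / 2) b c d Nr kr hr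
      obtain ⟨iT, eT⟩ := P.cellInt_merge_x hU (midpoint_between a b) c d il ir
      refine ⟨iT, ?_⟩
      rw [eT, hN]; push_cast; linarith
  | bY l r ihl ihr =>
      intro a b c d N hin h
      simp only [QB.eval, Params.mkY_z] at h
      obtain ⟨Nl, Nr, hl, hr, hN⟩ := addO_eq_some h
      obtain ⟨-, -, -, -, -, -, kl, kr⟩ := Params.InRootOrd.mid P hin
      obtain ⟨il, bl⟩ := ihl a b c ((c + d) / 2) Nl kl hl
      obtain ⟨ir, br⟩ := ihr a b ((c + d) / 2) d Nr kr hr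
      obtain ⟨iT, eT⟩ := P.cellInt_merge_y hU a b (midpoint_between c d) il ir
      refine ⟨iT, ?_⟩
      rw [eT, hN]; push_cast; linarith

/-- **STRUCTURAL CEILING SOUNDNESS (oriented form)**: `LeafCeilSoundOrd P → ∀ t, CeilSoundAt P t`. -/
theorem ceilSoundAt_of_leafCeilSoundOrd (P : Params) (hleaf : LeafCeilSoundOrd P) (t : QB) : CeilSoundAt P t := by
  intro N hP hN
  obtain ⟨hint, hle⟩ := eval_snd_sound_ord P hP hleaf t (-P.Xz) P.Xz (-P.Xz) P.Xz N (P.inRootOrd_root hP) hN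
  have hsub := P.brillouinZone_subset_rootCell hP
  refine ⟨hint.mono_set hsub, ?_⟩
  have hmono : (∫ p in brillouinZone, P.integrand p) ≤ P.cellInt (-P.Xz) P.Xz (-P.Xz) P.Xz :=
    setIntegral_mono_set hint (Filter.Eventually.of_forall fun p => P.integrand_nonneg p) (Filter.Eventually.of_forall hsub)
  linarith

end Summit.HubbardSuperconductivity.HubbardSuperconductivity.Theorems.KlLindhardEnclosure

end
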